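import Summits.HodgeConjecture.CorCM.IrreducibleOddWeightsCanonicalPivotFamilies
import Summits.HodgeConjecture.CorCM.IrreducibleOddWeightsCanonicalPivotCMFields
import HarnessLib

/-!
# Canonical pivot, V: FAMILIES of arbitrary CM fields — the exact defect `Σ_i dim Hg(A_i) − dim Hg(∏_i A_i)` from the
# classes of embeddings of each `K_j` agreeing on the trace of the compositum of the OTHER Galois closures; real traces
# force `Hg(∏_i A_i) = ∏_i Hg(A_i)` whatever the types

COR-CM (cell `pub-hodgecm2`, binder seat `b16` gen 65, count-neutral claim CANONICAL PIVOT, file C5 — CM fields and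
realisations; theorems only, no definition, no named fact, no `sorry`).  NEW as stated, hence under `Summits/`.  HONEST
FRAMING: an exact, hypothesis-free formula for the codimension of `Hg(∏_i A_i)` in `∏_i Hg(A_i)` for abelian varieties
with complex multiplication by arbitrary CM fields, and unconditional consequences; no Hodge class is claimed algebraic
beyond the tree's nondegenerate case; `HC_CM` is neither used nor asserted.

SETTING.  CM fields `K_i` (`i ∈ I` finite), types `Φ_i`, `u_i = 2·𝟙_{Φ_i} − 1`, realisations `A_i ⊨ (K_i; Φ_i)`; `Aut(ℂ)`
acts on all `Hom(K_i, ℂ)`; `L_i = normalClosure ℚ K_i ℂ` and `L_{≠j} = ⨆_{i≠j} L_i` (the compositum of the OTHER Galois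
closures).  File C4 (`IrreducibleOddWeightsCanonicalPivotFamilies`): for any `G`-sets,
`Σ_i dim Hg(A_i) − dim Hg(∏_i A_i) = Σ_j dim F_j − dim Σ_j F_j`, `F_j` spanned by the matrix coefficients of slot `j`
summed over the orbits of the pointwise stabiliser of all other slots.  Here `G = Aut(ℂ)`:

* §1 **`forall_ne_smul_eq_iff_forall_mem_iSup_normalClosure`** — that stabiliser is `Aut(ℂ/L_{≠j})`;
  **`exists_stabOthers_smul_eq_iff_forall_apply_eq`** — its orbits on `Hom(K_j, ℂ)` are the classes of embeddings
  AGREEING ON THE TRACE `t⁻¹(L_{≠j})` (Galois correspondence for `Aut(ℂ)` at `t(K_j) ∩ L_{≠j}`, as in C2).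
* §2 **`sum_cmTypeRank_add_one_add_finrank_iSup_traceSum_eq`** — FOR ANY FINITE FAMILY OF CM FIELDS AND TYPES:
  `Σ_i cmTypeRank Φ_i + 1 + dim ⨆_j F_j = cmFamilyRank Φ + |I| + Σ_j dim F_j`, i.e.
  **`Σ_i dim Hg(A_i) − dim Hg(∏_i A_i) = Σ_j dim F_j − dim Σ_j F_j`** with
  `F_j = span{ g ↦ Σ_{t : t = a on a⁻¹(L_{≠j})} u_j(g ∘ t) : a ∈ Hom(K_j, ℂ) }`; additive iff the `F_j` are independent
  (`cmFamilyRank_add_card_eq_iff_iSupIndep_stabOthersSum`).  Gen 64 R5/R5b needed a common Galois pivot below all the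
  fields with (GL); nothing is needed here.
* §3 TYPE-FREE: **`cmFamilyRank_add_card_eq_of_forall_ne_conj_apply_eq`** — if for every `j` (or every `j` but one) and
  every embedding `a` of `K_j` the trace `a(K_j) ∩ L_{≠j}` is REAL, then **`Hg(∏_i A_i) = ∏_i Hg(A_i)` for ALL types**;
  then the family is nondegenerate iff every member is, every Hodge class on every `(⨁A∘π₁) × (⨁A∘π₂)` with disjoint
  slot maps is a sum of exterior products, and for nondegenerate `Φ_i` every `∏_i A_i^{k_i}` satisfies the Hodge
  conjecture (the tree's theorem for nondegenerate families).  The tree's `LinearlyDisjointCMFieldsHodge` asked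
  `L_j ∩ L_{≠j} = ℚ`; here only the trace ON `K_j` must be real.

## References

* [Gordon1999HodgeAVSurvey] B. B. Gordon, *A survey of the Hodge conjecture for abelian varieties*, §3 Theorem (Imai,
  Murty) with proof, 7.5–7.7, 9.4.3, 10.10.
* [MoonenZarhin1999LowDim] B. Moonen, Yu. Zarhin, Math. Ann. 315 (1999), Thm. (0.2), §3 (3.1).
* [Lang2002] S. Lang, *Algebra*, 3rd ed., VI §1 Thm. 1.1, Cor. 1.6, Thm. 1.14 and V §2 Thm. 2.8.
* [Deligne1982HodgeCycles] P. Deligne, *Hodge cycles on abelian varieties*, LNM 900 (1982), I.5 (p. 62), I Ex. 3.7.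
-/

set_option autoImplicit false

noncomputable section

open scoped BigOperators Classical

open CategoryTheory CategoryTheory.Limits NumberField Module IntermediateField

namespace Summit.HodgeConjecture.CorCM

open Literature.NumberTheory.ComplexMultiplication
open Literature.NumberTheory.NumberFields (mem_closure_fixing_union_of_apply_eq)
open Literature.AlgebraicGeometry.Motives (AbelianVariety CMType)
open Literature.AlgebraicGeometry.Motives.AbelianVariety
open Literature.AlgebraicGeometry.HodgeTheory
open Literature.AlgebraicGeometry.ComplexMultiplication (IsCMTypeRealisation)
open Literature.AlgebraicGeometry.Pohlmann1968

/-! ### §1 The pointwise stabiliser of all other slots and the trace description of its orbits -/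

section Orbits

variable {I : Type} {K : I → Type} [∀ i, Field (K i)] [∀ i, NumberField (K i)]

omit [∀ i, NumberField (K i)] in
/-- An automorphism of `ℂ` fixes `ℚ`. [folklore] -/
private theorem ringEquiv_apply_algebraMap₅ (g : ℂ ≃+* ℂ) (q : ℚ) : g (algebraMap ℚ ℂ q) = algebraMap ℚ ℂ q := by
  rw [eq_ratCast]
  exact map_ratCast g q

/-- **`⋂_{i≠j} PW_i = Aut(ℂ/L_{≠j})`**: an automorphism of `ℂ` fixes every embedding of every `K_i`, `i ≠ j`, iff it fixes
the compositum `L_{≠j} = ⨆_{i≠j} normalClosure ℚ K_i ℂ` of their Galois closures pointwise.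
[cite: Lang2002, VI §1 Thm. 1.14 and V §2 Thm. 2.8] -/
theorem forall_ne_smul_eq_iff_forall_mem_iSup_normalClosure (j : I) (n : ℂ ≃+* ℂ) :
    (∀ i, i ≠ j → ∀ y : K i →+* ℂ, n • y = y) ↔
      ∀ z : ℂ, z ∈ (⨆ i : {i : I // i ≠ j}, normalClosure ℚ (K i.1) ℂ) → n z = z := by
  constructor
  · intro h
    let φ : ℂ →ₐ[ℚ] ℂ := (AlgEquiv.ofRingEquiv (f := n) (ringEquiv_apply_algebraMap₅ n)).toAlgHom
    let D : IntermediateField ℚ ℂ :=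
      ⟨AlgHom.equalizer φ (AlgHom.id ℚ ℂ), fun y (hy : n y = y) => show n y⁻¹ = y⁻¹ by rw [map_inv₀, hy]⟩
    have hle : (⨆ i : {i : I // i ≠ j}, normalClosure ℚ (K i.1) ℂ) ≤ D :=
      iSup_le fun i => fun z hz => (forall_smul_eq_iff_forall_mem_normalClosure i.1 n).1 (h i.1 i.2) z hz
    exact fun z hz => hle hz
  · intro h i hi
    exact (forall_smul_eq_iff_forall_mem_normalClosure i n).2 fun z hz =>
      h z (le_iSup (fun i : {i : I // i ≠ j} => normalClosure ℚ (K i.1) ℂ) ⟨i, hi⟩ hz)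

variable [Fintype I]

/-- **THE TRACE DESCRIPTION, FAMILIES**: `t'` is a translate of `t : K_j → ℂ` by an automorphism fixing every embedding
of every other field **iff `t'` and `t` agree on the trace field `t⁻¹(L_{≠j})`** (the Galois correspondence for
`Aut(ℂ)` at `t(K_j) ∩ L_{≠j}`, and normality of `Aut(ℂ/L_{≠j})`). [cite: Lang2002, VI §1 Thm. 1.1, Cor. 1.6 and V §2 Thm. 2.8] -/
theorem exists_stabOthers_smul_eq_iff_forall_apply_eq (j : I) (t t' : K j →+* ℂ) :
    (∃ n : ℂ ≃+* ℂ, (∀ i, i ≠ j → ∀ y : K i →+* ℂ, n • y = y) ∧ n • t = t') ↔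
      ∀ k : K j, t k ∈ (⨆ i : {i : I // i ≠ j}, normalClosure ℚ (K i.1) ℂ) → t' k = t k := by
  constructor
  · rintro ⟨n, hn, rfl⟩ k hk
    rw [ringEquiv_smul_apply]
    exact (forall_ne_smul_eq_iff_forall_mem_iSup_normalClosure j n).1 hn _ hk
  · intro h
    haveI := isPretransitive_ringEquiv_complex (K := K j)
    obtain ⟨g, hg⟩ := MulAction.exists_smul_eq (ℂ ≃+* ℂ) t t'
    haveI : FiniteDimensional ℚ (t.toRatAlgHom).fieldRange :=
      LinearEquiv.finiteDimensional (AlgEquiv.ofInjectiveField t.toRatAlgHom).toLinearEquiv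
    have hfix : ∀ x : ℂ, x ∈ (t.toRatAlgHom).fieldRange →
        x ∈ (⨆ i : {i : I // i ≠ j}, normalClosure ℚ (K i.1) ℂ) → g x = x := by
      intro x hx hx₁
      obtain ⟨k, rfl⟩ := AlgHom.mem_fieldRange.1 hx
      change g (t k) = t k
      have h1 := h k hx₁
      rw [← hg, ringEquiv_smul_apply] at h1
      exact h1
    have hmem := mem_closure_fixing_union_of_apply_eq hfix
    have key : ∀ s ∈ Subgroup.closure
        ({σ : ℂ ≃+* ℂ | ∀ x : ℂ, x ∈ (t.toRatAlgHom).fieldRange → σ x = x} ∪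
          {σ : ℂ ≃+* ℂ | ∀ x : ℂ, x ∈ (⨆ i : {i : I // i ≠ j}, normalClosure ℚ (K i.1) ℂ) → σ x = x}),
        ∃ n : ℂ ≃+* ℂ, (∀ i, i ≠ j → ∀ y : K i →+* ℂ, n • y = y) ∧ n • t = s • t := by
      intro s hs
      induction hs using Subgroup.closure_induction with
      | mem s hs =>
        rcases hs with hs | hs
        · refine ⟨1, fun i _ y => one_smul _ y, ?_⟩
          rw [one_smul]
          refine (RingHom.ext fun k => ?_).symm
          rw [ringEquiv_smul_apply]
          exact hs _ (AlgHom.mem_fieldRange.2 ⟨k, rfl⟩)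
        · exact ⟨s, (forall_ne_smul_eq_iff_forall_mem_iSup_normalClosure j s).2 hs, rfl⟩
      | one => exact ⟨1, fun i _ y => one_smul _ y, rfl⟩
      | mul a b _ _ ha hb =>
        obtain ⟨na, hna, hnat⟩ := ha
        obtain ⟨nb, hnb, hnbt⟩ := hb
        refine ⟨a * nb * a⁻¹ * na, fun i hi y => ?_, ?_⟩
        · rw [mul_smul, mul_smul, mul_smul, hna i hi, hnb i hi, smul_inv_smul]
        · rw [mul_smul, mul_smul, mul_smul, hnat, inv_smul_smul, hnbt, mul_smul]
      | inv a _ ha =>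
        obtain ⟨na, hna, hnat⟩ := ha
        refine ⟨a⁻¹ * na⁻¹ * a, fun i hi y => ?_, ?_⟩
        · rw [mul_smul, mul_smul, inv_smul_eq_iff.2 (hna i hi (a • y)).symm, inv_smul_smul]
        · rw [mul_smul, mul_smul, ← hnat, inv_smul_smul]
    obtain ⟨n, hn, hnt⟩ := key g hmem
    exact ⟨n, hn, hnt.trans hg⟩

/-- The orbit sums over `Aut(ℂ/L_{≠j})` are the sums over the trace classes (a `Submodule` equality for rewriting).
[cite: Lang2002, VI §1 Thm. 1.1 and Cor. 1.6] -/
theorem span_stabOthersSum_eq_span_traceSum (j : I) (Φj : CMType (K j)) :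
    Submodule.span ℚ (Set.range fun a : K j →+* ℂ => fun g : ℂ ≃+* ℂ =>
        ∑ t ∈ Finset.univ.filter
          (fun t : K j →+* ℂ => ∃ n : ℂ ≃+* ℂ, (∀ i, i ≠ j → ∀ y : K i →+* ℂ, n • y = y) ∧ n • a = t),
            antiVec Φj.1 g t) =
      Submodule.span ℚ (Set.range fun a : K j →+* ℂ => fun g : ℂ ≃+* ℂ =>
        ∑ t ∈ Finset.univ.filter
          (fun t : K j →+* ℂ => ∀ k : K j, a k ∈ (⨆ i : {i : I // i ≠ j}, normalClosure ℚ (K i.1) ℂ) → t k = a k),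
            antiVec Φj.1 g t) := by
  have e : ∀ a : K j →+* ℂ, Finset.univ.filter
      (fun t : K j →+* ℂ => ∃ n : ℂ ≃+* ℂ, (∀ i, i ≠ j → ∀ y : K i →+* ℂ, n • y = y) ∧ n • a = t) =
        Finset.univ.filter (fun t : K j →+* ℂ =>
          ∀ k : K j, a k ∈ (⨆ i : {i : I // i ≠ j}, normalClosure ℚ (K i.1) ℂ) → t k = a k) := fun a =>
    Finset.filter_congr fun t _ => exists_stabOthers_smul_eq_iff_forall_apply_eq j a t
  simp only [e]

/-- **A real trace makes every orbit conjugation-stable** (families). [cite: Lang2002, VI §1 Cor. 1.6] -/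
theorem exists_stabOthers_smul_eq_conj_of_forall_conj_apply_eq (j : I) (a : K j →+* ℂ)
    (hreal : ∀ k : K j, a k ∈ (⨆ i : {i : I // i ≠ j}, normalClosure ℚ (K i.1) ℂ) → starRingEnd ℂ (a k) = a k) :
    ∃ n : ℂ ≃+* ℂ, (∀ i, i ≠ j → ∀ y : K i →+* ℂ, n • y = y) ∧ n • a = (starRingAut : ℂ ≃+* ℂ) • a :=
  (exists_stabOthers_smul_eq_iff_forall_apply_eq j a _).2 fun k hk => by
    rw [ringEquiv_smul_apply, starRingAut_apply, ← starRingEnd_apply, hreal k hk]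

end Orbits

/-! ### §2 The exact family defect for arbitrary CM fields -/

section Rank

variable {I : Type} [Fintype I] {K : I → Type} [∀ i, Field (K i)] [∀ i, NumberField (K i)] [∀ i, IsCMField (K i)]

/-- **THE EXACT FAMILY DEFECT FOR ARBITRARY CM FIELDS (orbit form)**:
`Σ_i cmTypeRank Φ_i + 1 + dim ⨆_j F_j = cmFamilyRank Φ + |I| + Σ_j dim F_j`, i.e.
**`Σ_i dim Hg(A_i) − dim Hg(∏_i A_i) = Σ_j dim F_j − dim Σ_j F_j`**, `F_j ≤ ℚ^{Aut(ℂ)}` spanned by the functions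
`g ↦ Σ_{t ∈ Aut(ℂ/L_{≠j})·a} u_j(g ∘ t)`, `a ∈ Hom(K_j, ℂ)`.  NO hypothesis.
[cite: Gordon1999HodgeAVSurvey, §3 Theorem and 7.5–7.7] [cite: Deligne1982HodgeCycles, I.5 (p. 62)] -/
theorem sum_cmTypeRank_add_one_add_finrank_iSup_stabOthersSum_eq [Nonempty I] (Φ : ∀ i, CMType (K i)) :
    (∑ i, cmTypeRank (Φ i)) + 1 + Module.finrank ℚ (⨆ j, Submodule.span ℚ (Set.range fun a : K j →+* ℂ =>
        fun g : ℂ ≃+* ℂ => ∑ t ∈ Finset.univ.filter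
          (fun t : K j →+* ℂ => ∃ n : ℂ ≃+* ℂ, (∀ i, i ≠ j → ∀ y : K i →+* ℂ, n • y = y) ∧ n • a = t),
            antiVec (Φ j).1 g t) : Submodule ℚ ((ℂ ≃+* ℂ) → ℚ)) =
      CMAlgebra.cmFamilyRank Φ + Fintype.card I +
        ∑ j, Module.finrank ℚ (Submodule.span ℚ (Set.range fun a : K j →+* ℂ => fun g : ℂ ≃+* ℂ =>
          ∑ t ∈ Finset.univ.filter
            (fun t : K j →+* ℂ => ∃ n : ℂ ≃+* ℂ, (∀ i, i ≠ j → ∀ y : K i →+* ℂ, n • y = y) ∧ n • a = t),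
              antiVec (Φ j).1 g t)) := by
  haveI : ∀ i, Nonempty (K i →+* ℂ) := fun i => inferInstance
  exact IrrOdd.sum_typeRank_add_one_add_finrank_iSup_stabOrbitSum_eq (G := ℂ ≃+* ℂ) (E := fun i => K i →+* ℂ)
    (Φ := fun i => (Φ i).1) (fun i => isCMTypeWith_conj (Φ i))

/-- **THE EXACT FAMILY DEFECT, TRACE FORM** — each `F_j` written over the classes of embeddings of `K_j` agreeing on
the trace `a⁻¹(L_{≠j})`: **`Σ_i dim Hg(A_i) − dim Hg(∏_i A_i) = Σ_j dim F_j − dim Σ_j F_j`**, a finite computation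
from the fields and types alone. [cite: Gordon1999HodgeAVSurvey, §3 Theorem and 7.5–7.7] [cite: Lang2002, VI §1 Thm. 1.14] -/
theorem sum_cmTypeRank_add_one_add_finrank_iSup_traceSum_eq [Nonempty I] (Φ : ∀ i, CMType (K i)) :
    (∑ i, cmTypeRank (Φ i)) + 1 + Module.finrank ℚ (⨆ j, Submodule.span ℚ (Set.range fun a : K j →+* ℂ =>
        fun g : ℂ ≃+* ℂ => ∑ t ∈ Finset.univ.filter (fun t : K j →+* ℂ =>
          ∀ k : K j, a k ∈ (⨆ i : {i : I // i ≠ j}, normalClosure ℚ (K i.1) ℂ) → t k = a k),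
            antiVec (Φ j).1 g t) : Submodule ℚ ((ℂ ≃+* ℂ) → ℚ)) =
      CMAlgebra.cmFamilyRank Φ + Fintype.card I +
        ∑ j, Module.finrank ℚ (Submodule.span ℚ (Set.range fun a : K j →+* ℂ => fun g : ℂ ≃+* ℂ =>
          ∑ t ∈ Finset.univ.filter (fun t : K j →+* ℂ =>
            ∀ k : K j, a k ∈ (⨆ i : {i : I // i ≠ j}, normalClosure ℚ (K i.1) ℂ) → t k = a k),
              antiVec (Φ j).1 g t)) := by
  have h := sum_cmTypeRank_add_one_add_finrank_iSup_stabOthersSum_eq Φ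
  have e := fun j : I => span_stabOthersSum_eq_span_traceSum j (Φ j)
  have e2 : (∑ j, Module.finrank ℚ (Submodule.span ℚ (Set.range fun a : K j →+* ℂ => fun g : ℂ ≃+* ℂ =>
      ∑ t ∈ Finset.univ.filter
        (fun t : K j →+* ℂ => ∃ n : ℂ ≃+* ℂ, (∀ i, i ≠ j → ∀ y : K i →+* ℂ, n • y = y) ∧ n • a = t),
          antiVec (Φ j).1 g t))) =
      ∑ j, Module.finrank ℚ (Submodule.span ℚ (Set.range fun a : K j →+* ℂ => fun g : ℂ ≃+* ℂ =>
        ∑ t ∈ Finset.univ.filter (fun t : K j →+* ℂ =>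
          ∀ k : K j, a k ∈ (⨆ i : {i : I // i ≠ j}, normalClosure ℚ (K i.1) ℂ) → t k = a k),
            antiVec (Φ j).1 g t)) :=
    Finset.sum_congr rfl fun j _ => by rw [e j]
  rw [iSup_congr e, e2] at h
  exact h

/-- **`Hg(∏_i A_i) = ∏_i Hg(A_i)` IFF the spaces `F_j` are INDEPENDENT** (orbit form; arbitrary CM fields and types).
[cite: Gordon1999HodgeAVSurvey, §3 Theorem and 7.5–7.7] -/
theorem cmFamilyRank_add_card_eq_iff_iSupIndep_stabOthersSum [Nonempty I] (Φ : ∀ i, CMType (K i)) :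
    CMAlgebra.cmFamilyRank Φ + Fintype.card I = (∑ i, cmTypeRank (Φ i)) + 1 ↔
      iSupIndep fun j => Submodule.span ℚ (Set.range fun a : K j →+* ℂ => fun g : ℂ ≃+* ℂ =>
        ∑ t ∈ Finset.univ.filter
          (fun t : K j →+* ℂ => ∃ n : ℂ ≃+* ℂ, (∀ i, i ≠ j → ∀ y : K i →+* ℂ, n • y = y) ∧ n • a = t),
            antiVec (Φ j).1 g t) := by
  haveI : ∀ i, Nonempty (K i →+* ℂ) := fun i => inferInstance
  exact IrrOdd.typeRank_sigmaType_add_card_eq_iff_iSupIndep_stabOrbitSum (G := ℂ ≃+* ℂ) (E := fun i => K i →+* ℂ)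
    (Φ := fun i => (Φ i).1) (fun i => isCMTypeWith_conj (Φ i))

/-! ### §3 Type-free consequences: real traces -/

/-- **REAL TRACES FORCE `Hg(∏_i A_i) = ∏_i Hg(A_i)` FOR ALL TYPES**: if for every slot `j` except possibly `j₀`, and
every embedding `a` of `K_j`, the elements of `a(K_j) ∩ L_{≠j}` are real, then
`cmFamilyRank Φ + |I| = Σ_i cmTypeRank Φ_i + 1` for EVERY family of CM types.
[cite: Gordon1999HodgeAVSurvey, §3 Theorem (proof) and 7.5–7.7] [cite: MoonenZarhin1999LowDim, Thm. (0.2)] -/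
theorem cmFamilyRank_add_card_eq_of_forall_ne_conj_apply_eq [Nonempty I] (Φ : ∀ i, CMType (K i)) (j₀ : I)
    (hreal : ∀ j : I, j ≠ j₀ → ∀ (a : K j →+* ℂ) (k : K j),
      a k ∈ (⨆ i : {i : I // i ≠ j}, normalClosure ℚ (K i.1) ℂ) → starRingEnd ℂ (a k) = a k) :
    CMAlgebra.cmFamilyRank Φ + Fintype.card I = (∑ i, cmTypeRank (Φ i)) + 1 := by
  haveI : ∀ i, Nonempty (K i →+* ℂ) := fun i => inferInstance
  exact IrrOdd.typeRank_sigmaType_add_card_eq_of_forall_ne_stabOrbit_rho_stable (G := ℂ ≃+* ℂ)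
    (E := fun i => K i →+* ℂ) (Φ := fun i => (Φ i).1) (fun i => isCMTypeWith_conj (Φ i)) j₀
    fun j hj a => exists_stabOthers_smul_eq_conj_of_forall_conj_apply_eq j a (hreal j hj a)

/-- **INTRINSIC FORM: every trace `a⁻¹(L_{≠j})` (`j ≠ j₀`) inside the MAXIMAL REAL SUBFIELD `K_j⁺` ⟹
`Hg(∏_i A_i) = ∏_i Hg(A_i)` for all types.** [cite: Gordon1999HodgeAVSurvey, §3 Theorem (proof) and 7.5–7.7] -/
theorem cmFamilyRank_add_card_eq_of_forall_ne_mem_maximalRealSubfield [Nonempty I] (Φ : ∀ i, CMType (K i)) (j₀ : I)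
    (htr : ∀ j : I, j ≠ j₀ → ∀ (a : K j →+* ℂ) (k : K j),
      a k ∈ (⨆ i : {i : I // i ≠ j}, normalClosure ℚ (K i.1) ℂ) → k ∈ maximalRealSubfield (K j)) :
    CMAlgebra.cmFamilyRank Φ + Fintype.card I = (∑ i, cmTypeRank (Φ i)) + 1 :=
  cmFamilyRank_add_card_eq_of_forall_ne_conj_apply_eq Φ j₀ fun j hj a k hk => by
    rw [starRingEnd_apply]
    exact (mem_maximalRealSubfield_iff k).1 (htr j hj a k hk) a

/-- **… then the family is nondegenerate iff every member is.** [cite: Gordon1999HodgeAVSurvey, 7.5–7.6.1] -/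
theorem isNondegenerateFamily_iff_forall_of_forall_ne_conj_apply_eq [Nonempty I] (Φ : ∀ i, CMType (K i)) (j₀ : I)
    (hreal : ∀ j : I, j ≠ j₀ → ∀ (a : K j →+* ℂ) (k : K j),
      a k ∈ (⨆ i : {i : I // i ≠ j}, normalClosure ℚ (K i.1) ℂ) → starRingEnd ℂ (a k) = a k) :
    CMAlgebra.IsNondegenerateFamily Φ ↔ ∀ i, IsNondegenerate (Φ i) :=
  isNondegenerateFamily_iff_forall_of_cmFamilyRank_add_card_eq Φ
    (cmFamilyRank_add_card_eq_of_forall_ne_conj_apply_eq Φ j₀ hreal)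

variable {Φ : ∀ i, CMType (K i)} {A : I → AbelianVariety ℂ} {ιA : ∀ i, 𝓞 (K i) →+* End (A i)}
  {θ : ∀ i, K i →+* Module.End ℂ (complexBetti (A i).X 1)}

/-- **… and then every rational Hodge class on every `(⨁_l A_{π₁ l}) × (⨁_l A_{π₂ l})` with disjoint slot maps is a
`ℂ`-combination of exterior products**: no mixed exceptional classes, whatever the types.
[cite: MoonenZarhin1999LowDim, §3 (3.1)] [cite: Gordon1999HodgeAVSurvey, 7.5–7.7] -/
theorem forall_hodgeClassesProductSpan_of_forall_ne_conj_apply_eq [Nonempty I] (j₀ : I)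
    (hreal : ∀ j : I, j ≠ j₀ → ∀ (a : K j →+* ℂ) (k : K j),
      a k ∈ (⨆ i : {i : I // i ≠ j}, normalClosure ℚ (K i.1) ℂ) → starRingEnd ℂ (a k) = a k)
    (hA : ∀ i, IsCMTypeRealisation (Φ i) (A i) (ιA i) (θ i)) (N₁ N₂ : ℕ) [NeZero N₁] [NeZero N₂] (π₁ : Fin N₁ → I)
    (π₂ : Fin N₂ → I) (hdisj : ∀ l₁ l₂, π₁ l₁ ≠ π₂ l₂) :
    HodgeClassesProductSpan (⨁ fun l => A (π₁ l)) (⨁ fun l => A (π₂ l)) :=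
  (cmFamilyRank_add_card_eq_iff_forall_hodgeClassesProductSpan hA).1
    (cmFamilyRank_add_card_eq_of_forall_ne_conj_apply_eq Φ j₀ hreal) N₁ N₂ π₁ π₂ hdisj

/-- **… and for NONDEGENERATE types every product `⨁_l A_{π l}` (every `∏_i A_i^{k_i}`) satisfies the Hodge conjecture,
unconditionally** (the family is nondegenerate; the tree's Pohlmann–Gordon theorem).
[cite: Gordon1999HodgeAVSurvey, 10.10 and 7.5] [cite: MoonenZarhin1999LowDim, Thm. (0.2)] -/
theorem hodgeConjectureFor_prod_of_forall_ne_conj_apply_eq [Nonempty I] (j₀ : I)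
    (hreal : ∀ j : I, j ≠ j₀ → ∀ (a : K j →+* ℂ) (k : K j),
      a k ∈ (⨆ i : {i : I // i ≠ j}, normalClosure ℚ (K i.1) ℂ) → starRingEnd ℂ (a k) = a k)
    (hnd : ∀ i, IsNondegenerate (Φ i)) (hA : ∀ i, IsCMTypeRealisation (Φ i) (A i) (ιA i) (θ i)) {N : ℕ}
    (π : Fin N → I) :
    HodgeConjectureFor (⨁ fun l : Fin N => A (π l)).dim (⨁ fun l : Fin N => A (π l)).X :=
  ((isNondegenerateFamily_iff_forall_of_forall_ne_conj_apply_eq Φ j₀ hreal).2 hnd).hodgeConjectureFor_prod hA π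

end Rank

end Summit.HodgeConjecture.CorCM

end
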